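import Mathlib
import Summits.ValiantsHypothesis.ValiantsHypothesis.Theorems.LacunarySymmetroidMatrixDescartesOsculationLawRecursionTransferStep

/-!
# `MatrixDescartes` (stmt-ValiantsHypothesis-18050), line `osculation_law`, stub `stub_recursion` — R5′: the `K`-induction
# INSIDE a hereditary (truncation-closed) family in the MULTIPLICITY currency, and ONE dense transfer per format

Helper file (`--supports stmt-ValiantsHypothesis-18050 --as helper`; cell val-lit, seat val-port-3 g1, merged desk g12;
the ROUTE′ shape agreed on the bus with val-lit-p6 g14 / val-lit-p7 g13 / val-lit-p4 g13 / val-lit-p8 g12 (12:09Z): no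
«simple roots» clause is needed when the induction hypothesis lives on the family).  Closes NO item.  0 defs.

Compared with `…RecursionTransferStep` (transfer at EVERY level, induction hypothesis = `PosRootLawAt` in the
distinct currency, which forces a «simple positive roots» clause on the node family), here the induction hypothesis
is the MULTIPLICITY bound on the members of a HEREDITARY family `N K d` (`S ∈ N (K+1) d → Fin.init S ∈ N K (Fin.init d)`),
exactly val-lit-p8 g12's SPEC R5 `recursion_of_step`; the passage to every symmetric pencil and to the distinct
currency happens once per format by `DenseTransfer.card_posRoots_le_of_dense_mult_reindex`.

* **`zmult_le_of_hereditary`** — hereditary family + node step `Zmult(d, S) ≤ 4·Zmult(init d, init S) + A K` for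
  `S ∈ N (K+1) d` ⇒ `Zmult(d, S) ≤ ∑_{j<K} 4^{K-1-j} · A j` for every `S ∈ N K d` (level `0`: no letters, no roots);
* **`posRootLawAt_of_hereditary`** — plus density of `N K d` among the symmetric pencils on every normal-form support
  (`ι ≃ Fin m`) ⇒ `PosRootLawAt m K (∑_{j<K} 4^{K-1-j} · A j)`;
* **`posKPlusLogSq_of_hereditary`** — plus a node cost of envelope shape `A m K ≤ a·2^{C₀(K+1+log₂² m)} + b·m`
  ⇒ `∃ C, ∀ m K, PosRootLawAt m K (2^{C (K + log₂² m)})` (= the line's `PosKPlusLogSqLaw`, unfolded).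

[folklore] Induction and bookkeeping.  Honest framing: the node step (R3/R4′), the density of the node family (R6(a)),
the osculation LAW, `MatrixDescartes` (18050), Conjecture B and VP ≠ VNP are NOT proved here.
-/

set_option linter.dupNamespace false

namespace Summit.ValiantsHypothesis.ValiantsHypothesis.Theorems.LacunarySymmetroidMatrixDescartes.RecursionTransfer

open Polynomial Matrix Filter Topology
open scoped BigOperators
open Summit.ValiantsHypothesis.ValiantsHypothesis.Theorems.MatrixDescartes.Negative (PosRootLawAt)

variable {m : ℕ} {ι : Type*} [Fintype ι] [DecidableEq ι]

/-! ## The induction inside the family -/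

/-- A pencil with no letters has no positive det-root counted with multiplicity. [folklore] -/
theorem zmult_zero_letters (d : Fin 0 → ℕ) (S : Fin 0 → Matrix ι ι ℝ) :
    Multiset.card (((∑ l, (X : ℝ[X]) ^ d l • (S l).map C).det.roots.filter (fun t => 0 < t))) = 0 := by
  classical
  rw [Multiset.card_eq_zero, Multiset.filter_eq_nil]
  intro t ht hpos
  simp only [Finset.univ_eq_empty, Finset.sum_empty] at ht
  rcases isEmpty_or_nonempty ι with hι | hι
  · rw [Matrix.det_isEmpty, Polynomial.roots_one] at ht
    simp at ht
  · rw [Matrix.det_zero, Polynomial.roots_zero] at ht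
    simp at ht

/-- **The `K`-induction inside a hereditary family** (val-lit-p8 g12's SPEC R5 `recursion_of_step`).  Let `N K d` be
families of `K`-letter pencils on `ι`, closed under truncation of the top letter, on which the node step
`Zmult(d, S) ≤ 4 · Zmult(init d, init S) + A K` holds at every level `K + 1`.  Then every member of `N K d`
satisfies `Zmult(d, S) ≤ ∑_{j<K} 4^{K-1-j} · A j`. [folklore] -/
theorem zmult_le_of_hereditary (A : ℕ → ℕ) (N : (K : ℕ) → (Fin K → ℕ) → Set (Fin K → Matrix ι ι ℝ))
    (hher : ∀ (K : ℕ) (d : Fin (K + 1) → ℕ) (S : Fin (K + 1) → Matrix ι ι ℝ),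
      S ∈ N (K + 1) d → Fin.init S ∈ N K (Fin.init d))
    (hstep : ∀ (K : ℕ) (d : Fin (K + 1) → ℕ), ∀ S ∈ N (K + 1) d,
      Multiset.card (((∑ l, (X : ℝ[X]) ^ d l • (S l).map C).det.roots.filter (fun t => 0 < t))) ≤
        4 * Multiset.card (((∑ l, (X : ℝ[X]) ^ (Fin.init d) l • ((Fin.init S) l).map C).det.roots.filter
          (fun t => 0 < t))) + A K) :
    ∀ (K : ℕ) (d : Fin K → ℕ), ∀ S ∈ N K d,
      Multiset.card (((∑ l, (X : ℝ[X]) ^ d l • (S l).map C).det.roots.filter (fun t => 0 < t))) ≤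
        ∑ j ∈ Finset.range K, 4 ^ (K - 1 - j) * A j := by
  classical
  intro K
  induction K with
  | zero =>
    intro d S _
    rw [zmult_zero_letters d S]
    exact Nat.zero_le _
  | succ K ih =>
    intro d S hS
    rw [recBound_succ]
    have h1 := hstep K d S hS
    have h2 := ih (Fin.init d) (Fin.init S) (hher K d S hS)
    omega

/-! ## One transfer per format -/

/-- **`PosRootLawAt` from a hereditary family**, dense among the symmetric pencils on every normal-form support
(`StrictMono d`, `d 0 = 0`) of a reindexed format `ι ≃ Fin m`. [folklore] -/
theorem posRootLawAt_of_hereditary (e : ι ≃ Fin m) (A : ℕ → ℕ)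
    (N : (K : ℕ) → (Fin K → ℕ) → Set (Fin K → Matrix ι ι ℝ))
    (hher : ∀ (K : ℕ) (d : Fin (K + 1) → ℕ) (S : Fin (K + 1) → Matrix ι ι ℝ),
      S ∈ N (K + 1) d → Fin.init S ∈ N K (Fin.init d))
    (hstep : ∀ (K : ℕ) (d : Fin (K + 1) → ℕ), ∀ S ∈ N (K + 1) d,
      Multiset.card (((∑ l, (X : ℝ[X]) ^ d l • (S l).map C).det.roots.filter (fun t => 0 < t))) ≤
        4 * Multiset.card (((∑ l, (X : ℝ[X]) ^ (Fin.init d) l • ((Fin.init S) l).map C).det.roots.filter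
          (fun t => 0 < t))) + A K)
    (hdense : ∀ (K : ℕ) (d : Fin (K + 1) → ℕ), StrictMono d → d 0 = 0 →
      ∀ (T : Fin (K + 1) → Matrix ι ι ℝ), (∀ l, (T l).IsSymm) → T ∈ closure (N (K + 1) d)) :
    ∀ K, PosRootLawAt m K (∑ j ∈ Finset.range K, 4 ^ (K - 1 - j) * A j) := by
  classical
  intro K
  rcases Nat.eq_zero_or_pos K with hK | hK
  · subst hK
    simpa using DenseTransfer.posRootLawAt_zero_letters (m := m) 0
  · obtain ⟨K, rfl⟩ : ∃ K', K = K' + 1 := ⟨K - 1, by omega⟩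
    exact DenseTransfer.posRootLawAt_of_dense_mult_reindex_strictMono e (N (K + 1))
      (fun d hd h0 T hT => hdense K d hd h0 T hT)
      (fun d _ _ S hS => zmult_le_of_hereditary A N hher hstep (K + 1) d S hS)

/-- **`PosKPlusLogSqLaw` from hereditary families** on reindexed formats `ι m ≃ Fin m` (e.g. `Fin m ⊕ Fin 0`): for
every size `m`, a hereditary family with the node step in the multiplicity currency at cost
`A m K ≤ a·2^{C₀(K+1+log₂² m)} + b·m`, dense among the symmetric pencils on every normal-form support, gives
`∃ C, ∀ m K, PosRootLawAt m K (2^{C (K + log₂² m)})`. [folklore] -/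
theorem posKPlusLogSq_of_hereditary (ι : ℕ → Type*) [∀ m, Fintype (ι m)] [∀ m, DecidableEq (ι m)]
    (e : ∀ m, ι m ≃ Fin m) (A : ℕ → ℕ → ℕ) (a b C₀ : ℕ)
    (hA : ∀ m K, A m K ≤ a * 2 ^ (C₀ * (K + 1 + Nat.log 2 m ^ 2)) + b * m)
    (N : (m K : ℕ) → (Fin K → ℕ) → Set (Fin K → Matrix (ι m) (ι m) ℝ))
    (hher : ∀ (m K : ℕ) (d : Fin (K + 1) → ℕ) (S : Fin (K + 1) → Matrix (ι m) (ι m) ℝ),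
      S ∈ N m (K + 1) d → Fin.init S ∈ N m K (Fin.init d))
    (hstep : ∀ (m K : ℕ) (d : Fin (K + 1) → ℕ), ∀ S ∈ N m (K + 1) d,
      Multiset.card (((∑ l, (X : ℝ[X]) ^ d l • (S l).map C).det.roots.filter (fun t => 0 < t))) ≤
        4 * Multiset.card (((∑ l, (X : ℝ[X]) ^ (Fin.init d) l • ((Fin.init S) l).map C).det.roots.filter
          (fun t => 0 < t))) + A m K)
    (hdense : ∀ (m K : ℕ) (d : Fin (K + 1) → ℕ), StrictMono d → d 0 = 0 →
      ∀ (T : Fin (K + 1) → Matrix (ι m) (ι m) ℝ), (∀ l, (T l).IsSymm) → T ∈ closure (N m (K + 1) d)) :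
    ∃ C : ℕ, ∀ m K : ℕ, PosRootLawAt m K (2 ^ (C * (K + Nat.log 2 m ^ 2))) := by
  obtain ⟨C, hC⟩ := exists_exponent_envelope A a b C₀ hA
  refine ⟨C, fun m K d S hS => ?_⟩
  exact (posRootLawAt_of_hereditary (e m) (A m) (N m) (hher m) (hstep m) (hdense m) K d S hS).trans (hC m K)

end Summit.ValiantsHypothesis.ValiantsHypothesis.Theorems.LacunarySymmetroidMatrixDescartes.RecursionTransfer
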